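import Summits.RiemannHypothesis.RiemannHypothesis.Theses.SpectralTrace
import Summits.RiemannHypothesis.RiemannHypothesis.Theorems.SpectralTraceSpectralThesisStubFixedPoint
import HarnessLib

/-!
# Crux `SpectralThesis` (stmt-RiemannHypothesis-0187), line `Sketch` — stub `stub_verify`

The exact cancellation at the fixed point of the BaseRung construction. Data: an even kernel `q`
reproducing on `[-A, A]` (`q ∗ ĝ = ĝ` for Weil tests supported there), a density `ν` with
`∫ ĝ ν = W(g)` there, a bounded continuous `f` with `f = q ∗ fract Φ`, the phase `Φ` with
`Φ' = ν + q' ∗ f`, and the warped Euler–Maclaurin identity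
`Σ_n ĝ(Ψ n) = ∫ ĝ Φ' + ∫ ĝ₁ fract Φ` (`ĝ₁ = (ixg)^ = ĝ'`). Then
`∫ ĝ Φ' = ∫ ĝ ν + ∫ ĝ (q' ∗ f) = W(g) − ∫ ĝ₁ (q ∗ f)` (parts on `ℝ`),
`∫ ĝ₁ (q ∗ f) = ∫ (q ∗ ĝ₁) f = ∫ ĝ₁ f` (Fubini, evenness, reproducing), and
`∫ ĝ₁ f = ∫ ĝ₁ (q ∗ fract Φ) = ∫ (q ∗ ĝ₁) fract Φ = ∫ ĝ₁ fract Φ` (the same), so the two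
correction terms cancel and the sum is `W(g)`.
-/

noncomputable section

set_option linter.dupNamespace false

open Complex Set MeasureTheory Filter
open scoped Real Topology

namespace Summit.RiemannHypothesis.RiemannHypothesis.Theorems.SpectralThesis.Sketch

open Literature.NumberTheory.LFunctions

namespace Verify

/-- Peetre-type inequality: `(1 + (t-s)²)⁻¹ ≤ 2 (1+t²) (1+s²)⁻¹`. [folklore] -/
theorem peetre (t s : ℝ) : (1 + (t - s) ^ 2)⁻¹ ≤ 2 * (1 + t ^ 2) * (1 + s ^ 2)⁻¹ := by
  have hX : (0 : ℝ) < 1 + (t - s) ^ 2 := by positivity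
  have hY : (0 : ℝ) < 1 + s ^ 2 := by positivity
  rw [inv_eq_one_div, inv_eq_one_div, mul_one_div, div_le_div_iff₀ hX hY, one_mul]
  nlinarith [sq_nonneg (t - s + t), sq_nonneg t, sq_nonneg (t - s), sq_nonneg s,
    mul_nonneg (sq_nonneg t) (sq_nonneg (t - s)), sq_nonneg (s - 2 * t)]

/-- **Fubini for a decaying transform against a smear of a bounded measurable function.**
For `‖G(t)‖ ≤ C_g/(1+t²)²`, an even continuous kernel `|q| ≤ Q/(1+x²)` and a bounded
a.e.-strongly measurable `w`:
`∫ G(t) (∫ q(t−s) w(s) ds) dt = ∫ (∫ q(s−t) G(t) dt) w(s) ds`. [folklore] -/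
theorem integral_mul_smear_swap {G : ℝ → ℂ} (hGc : Continuous G) {Cg : ℝ}
    (hGb : ∀ t, ‖G t‖ ≤ Cg / (1 + t ^ 2) ^ 2) {q : ℝ → ℝ} (hqc : Continuous q) {Q : ℝ}
    (hqb : ∀ x, |q x| ≤ Q / (1 + x ^ 2)) (hqeven : ∀ x, q (-x) = q x) {w : ℝ → ℝ}
    (hw : AEStronglyMeasurable w) {B : ℝ} (hwb : ∀ s, |w s| ≤ B) :
    (∫ t, G t * ((∫ s, q (t - s) * w s : ℝ) : ℂ)) =
      ∫ s, (∫ t, (q (s - t) : ℂ) * G t) * (w s : ℂ) := by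
  have hL : ∀ t, G t * ((∫ s, q (t - s) * w s : ℝ) : ℂ) =
      ∫ s, G t * ((q (t - s) * w s : ℝ) : ℂ) := by
    intro t
    rw [← integral_complex_ofReal, ← integral_const_mul]
  have hR : ∀ s, (∫ t, (q (s - t) : ℂ) * G t) * (w s : ℂ) =
      ∫ t, G t * ((q (t - s) * w s : ℝ) : ℂ) := by
    intro s
    rw [← integral_mul_const]
    congr 1 with t
    have : q (t - s) = q (s - t) := by rw [← hqeven, neg_sub]
    rw [this]; push_cast; ring
  simp_rw [hL, hR]
  refine integral_integral_swap ?_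
  have hCg : 0 ≤ Cg := by
    have := (norm_nonneg _).trans (hGb 0); simpa using this
  have hQ : 0 ≤ Q := by
    have h := (abs_nonneg _).trans (hqb 0); simpa using h
  have hBn : 0 ≤ B := (abs_nonneg _).trans (hwb 0)
  set p : ℝ → ℝ := fun t => 2 * Q * Cg * B * (1 + t ^ 2)⁻¹ with hp
  set r : ℝ → ℝ := fun s => (1 + s ^ 2)⁻¹ with hr
  have hpi : Integrable p := integrable_inv_one_add_sq.const_mul _
  have hri : Integrable r := integrable_inv_one_add_sq
  refine (hpi.mul_prod hri).mono' ?_ (Eventually.of_forall fun z => ?_)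
  · have h1 : AEStronglyMeasurable (fun z : ℝ × ℝ => G z.1 * ((q (z.1 - z.2) : ℝ) : ℂ))
        (volume.prod volume) :=
      (by fun_prop : Continuous fun z : ℝ × ℝ =>
        G z.1 * ((q (z.1 - z.2) : ℝ) : ℂ)).aestronglyMeasurable
    have h2 : AEStronglyMeasurable (fun z : ℝ × ℝ => ((w z.2 : ℝ) : ℂ)) (volume.prod volume) :=
      (Complex.continuous_ofReal.comp_aestronglyMeasurable hw).comp_snd
    refine (h1.mul h2).congr (Eventually.of_forall fun z => ?_)
    obtain ⟨t, s⟩ := z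
    simp only [Function.uncurry_apply_pair, Pi.mul_apply]
    push_cast; ring
  · obtain ⟨t, s⟩ := z
    simp only [Function.uncurry_apply_pair]
    rw [norm_mul, Complex.norm_real, Real.norm_eq_abs, abs_mul]
    have hT : (0 : ℝ) < 1 + t ^ 2 := by positivity
    have h1 : ‖G t‖ ≤ Cg * (1 + t ^ 2)⁻¹ * (1 + t ^ 2)⁻¹ := by
      refine (hGb t).trans_eq ?_
      field_simp
    have h2 : |q (t - s)| ≤ Q * (2 * (1 + t ^ 2) * (1 + s ^ 2)⁻¹) := by
      refine (hqb _).trans ?_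
      rw [div_eq_mul_inv]
      exact mul_le_mul_of_nonneg_left (peetre t s) hQ
    have h3 : |w s| ≤ B := hwb s
    calc ‖G t‖ * (|q (t - s)| * |w s|)
        ≤ (Cg * (1 + t ^ 2)⁻¹ * (1 + t ^ 2)⁻¹) * (Q * (2 * (1 + t ^ 2) * (1 + s ^ 2)⁻¹) * B) :=
          mul_le_mul h1 (mul_le_mul h2 h3 (abs_nonneg _) (by positivity)) (by positivity)
            (by positivity)
      _ = p t * r s := by
          simp only [hp, hr]; field_simp

/-- Integrability of `G · v` for a decaying transform `G` and a bounded continuous real `v`.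
[folklore] -/
theorem integrable_mul_bdd {G : ℝ → ℂ} (hGc : Continuous G) {Cg : ℝ}
    (hGb : ∀ t, ‖G t‖ ≤ Cg / (1 + t ^ 2) ^ 2) {v : ℝ → ℝ} (hvc : Continuous v) {B : ℝ}
    (hvb : ∀ t, |v t| ≤ B) : Integrable fun t => G t * (v t : ℂ) := by
  have hBn : 0 ≤ B := (abs_nonneg _).trans (hvb 0)
  refine Integrable.mono' (integrable_inv_one_add_sq.const_mul (Cg * B))
    (hGc.mul (continuous_ofReal.comp hvc)).aestronglyMeasurable (Eventually.of_forall fun t => ?_)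
  have hpos : (0 : ℝ) < 1 + t ^ 2 := by positivity
  have h1 : (1 : ℝ) ≤ 1 + t ^ 2 := by nlinarith [sq_nonneg t]
  have hG0 : 0 ≤ Cg / (1 + t ^ 2) ^ 2 := (norm_nonneg _).trans (hGb t)
  have hCg : 0 ≤ Cg := by
    have := (norm_nonneg _).trans (hGb 0); simpa using this
  rw [norm_mul, Complex.norm_real, Real.norm_eq_abs]
  calc ‖G t‖ * |v t| ≤ Cg / (1 + t ^ 2) ^ 2 * B := mul_le_mul (hGb t) (hvb t) (abs_nonneg _) hG0
    _ ≤ Cg / (1 + t ^ 2) * B := by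
        refine mul_le_mul_of_nonneg_right ?_ hBn
        rw [div_le_div_iff₀ (by positivity) hpos]
        calc Cg * (1 + t ^ 2) = Cg * (1 + t ^ 2) * 1 := (mul_one _).symm
          _ ≤ Cg * (1 + t ^ 2) * (1 + t ^ 2) := mul_le_mul_of_nonneg_left h1 (by positivity)
          _ = Cg * (1 + t ^ 2) ^ 2 := by ring
    _ = Cg * B * (1 + t ^ 2)⁻¹ := by field_simp

/-- A decaying transform times a bounded function tends to `0` along any filter finer than the
cocompact behaviour of `(1+t²)⁻¹`: here at `±∞`. [folklore] -/
theorem tendsto_mul_bdd_zero {G : ℝ → ℂ} {Cg : ℝ} (hGb : ∀ t, ‖G t‖ ≤ Cg / (1 + t ^ 2) ^ 2)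
    {v : ℝ → ℝ} {B : ℝ} (hvb : ∀ t, |v t| ≤ B) {l : Filter ℝ}
    (hl : Tendsto (fun t : ℝ => (1 + t ^ 2)⁻¹) l (𝓝 0)) :
    Tendsto (fun t => G t * (v t : ℂ)) l (𝓝 0) := by
  have hBn : 0 ≤ B := (abs_nonneg _).trans (hvb 0)
  have hCg : 0 ≤ Cg := by
    have := (norm_nonneg _).trans (hGb 0); simpa using this
  rw [tendsto_zero_iff_norm_tendsto_zero]
  have hmaj : Tendsto (fun t : ℝ => Cg * B * (1 + t ^ 2)⁻¹) l (𝓝 0) := by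
    simpa using hl.const_mul (Cg * B)
  refine squeeze_zero (fun t => norm_nonneg _) (fun t => ?_) hmaj
  have hpos : (0 : ℝ) < 1 + t ^ 2 := by positivity
  have h1 : (1 : ℝ) ≤ 1 + t ^ 2 := by nlinarith [sq_nonneg t]
  have hG0 : 0 ≤ Cg / (1 + t ^ 2) ^ 2 := (norm_nonneg _).trans (hGb t)
  rw [norm_mul, Complex.norm_real, Real.norm_eq_abs]
  calc ‖G t‖ * |v t| ≤ Cg / (1 + t ^ 2) ^ 2 * B := mul_le_mul (hGb t) (hvb t) (abs_nonneg _) hG0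
    _ ≤ Cg / (1 + t ^ 2) * B := by
        refine mul_le_mul_of_nonneg_right ?_ hBn
        rw [div_le_div_iff₀ (by positivity) hpos]
        calc Cg * (1 + t ^ 2) = Cg * (1 + t ^ 2) * 1 := (mul_one _).symm
          _ ≤ Cg * (1 + t ^ 2) * (1 + t ^ 2) := mul_le_mul_of_nonneg_left h1 (by positivity)
          _ = Cg * (1 + t ^ 2) ^ 2 := by ring
    _ = Cg * B * (1 + t ^ 2)⁻¹ := by field_simp

/-- `(1 + t²)⁻¹ → 0` at `+∞`. [folklore] -/
theorem tendsto_inv_one_add_sq_atTop : Tendsto (fun t : ℝ => (1 + t ^ 2)⁻¹) atTop (𝓝 0) := by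
  refine tendsto_inv_atTop_zero.comp ?_
  exact tendsto_atTop_add_const_left _ 1 (tendsto_pow_atTop two_ne_zero)

/-- `(1 + t²)⁻¹ → 0` at `−∞`. [folklore] -/
theorem tendsto_inv_one_add_sq_atBot : Tendsto (fun t : ℝ => (1 + t ^ 2)⁻¹) atBot (𝓝 0) := by
  have h : Tendsto (fun t : ℝ => (1 + (-t) ^ 2)⁻¹) atBot (𝓝 0) :=
    tendsto_inv_one_add_sq_atTop.comp tendsto_neg_atBot_atTop
  simpa using h

/-- **Parts on `ℝ` against a smear.** For a decaying `C¹` transform `G` with decaying derivative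
`G₁`, a `C¹` kernel `q` (`q' = dq`, both `O(1/(1+t²))`) and a bounded continuous `f`:
`∫ G(t) (∫ dq(t−r) f(r) dr) dt = −∫ G₁(t) (∫ q(t−r) f(r) dr) dt`. [folklore] -/
theorem integral_mul_deriv_smear {G G₁ : ℝ → ℂ} (hGd : ∀ t, HasDerivAt G (G₁ t) t)
    (hG₁c : Continuous G₁) {Cg : ℝ} (hGb : ∀ t, ‖G t‖ ≤ Cg / (1 + t ^ 2) ^ 2)
    (hG₁b : ∀ t, ‖G₁ t‖ ≤ Cg / (1 + t ^ 2) ^ 2) {q dq : ℝ → ℝ} (hq : ∀ t, HasDerivAt q (dq t) t)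
    (hdqc : Continuous dq) {Q : ℝ} (hqb : ∀ t, |q t| ≤ Q / (1 + t ^ 2))
    (hdqb : ∀ t, |dq t| ≤ Q / (1 + t ^ 2)) {f : ℝ → ℝ} (hfc : Continuous f) {B : ℝ}
    (hfb : ∀ r, |f r| ≤ B) :
    (∫ t, G t * ((∫ r, dq (t - r) * f r : ℝ) : ℂ)) =
      -∫ t, G₁ t * ((∫ r, q (t - r) * f r : ℝ) : ℂ) := by
  have hGc : Continuous G := continuous_iff_continuousAt.2 fun t => (hGd t).continuousAt
  have hqc : Continuous q := continuous_iff_continuousAt.2 fun t => (hq t).continuousAt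
  have hfm : AEStronglyMeasurable f := hfc.aestronglyMeasurable
  -- the smear `V` and its derivative `V'`
  have hVd : ∀ t, HasDerivAt (fun v => ∫ r, q (v - r) * f r) (∫ r, dq (t - r) * f r) t :=
    fun t => FixedPoint.hasDerivAt_integral_shift_mul hq hdqc hqb hdqb hfm hfb t
  have hVc : Continuous fun v => ∫ r, q (v - r) * f r :=
    continuous_iff_continuousAt.2 fun t => (hVd t).continuousAt
  have hV'c : Continuous fun v => ∫ r, dq (v - r) * f r :=
    FixedPoint.continuous_integral_shift_mul hdqc hdqb hfm hfb
  have hVb : ∀ t, |∫ r, q (t - r) * f r| ≤ (∫ s, |q s|) * B := fun t =>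
    FixedPoint.abs_integral_shift_mul_le hqc hqb hfb t
  have hV'b : ∀ t, |∫ r, dq (t - r) * f r| ≤ (∫ s, |dq s|) * B := fun t =>
    FixedPoint.abs_integral_shift_mul_le hdqc hdqb hfb t
  have hVdC : ∀ t, HasDerivAt (fun v => ((∫ r, q (v - r) * f r : ℝ) : ℂ))
      ((∫ r, dq (t - r) * f r : ℝ) : ℂ) t := fun t => (hVd t).ofReal_comp
  have h := integral_mul_deriv_eq_deriv_mul (u := G) (u' := G₁)
    (v := fun v => ((∫ r, q (v - r) * f r : ℝ) : ℂ))
    (v' := fun t => ((∫ r, dq (t - r) * f r : ℝ) : ℂ)) (a' := 0) (b' := 0)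
    (fun t _ => hGd t) (fun t _ => hVdC t)
    (integrable_mul_bdd hGc hGb hV'c hV'b) (integrable_mul_bdd hG₁c hG₁b hVc hVb)
    (tendsto_mul_bdd_zero hGb hVb tendsto_inv_one_add_sq_atBot)
    (tendsto_mul_bdd_zero hGb hVb tendsto_inv_one_add_sq_atTop)
  rw [h]
  simp

end Verify

/-- **STUB · `stub_verify`** — the exact cancellation at the fixed point of the BaseRung
construction: with `q` even and reproducing on `[-A, A]`, `∫ ĝ ν = W(g)` there, `f = q ∗ fract Φ`,
`Φ' = ν + q' ∗ f`, and the warped Euler–Maclaurin identity, `Σ_n ĝ(Ψ n) = W(g)` for every Weil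
test supported in `(-A, A)` (`∫ ĝ (q' ∗ f) = −∫ ĝ₁ f = −∫ ĝ₁ fract Φ`). [folklore] -/
theorem stub_verify :
    ∀ (A : ℝ) (q dq ν f Φ dΦ Ψ : ℝ → ℝ) (Q B : ℝ), 0 < A →
      (∀ t, HasDerivAt q (dq t) t) → Continuous dq → (∀ t, q (-t) = q t) →
      (∀ t, |q t| ≤ Q / (1 + t ^ 2)) → (∀ t, |dq t| ≤ Q / (1 + t ^ 2)) →
      (∀ g : ℝ → ℂ, IsWeilTest g → tsupport g ⊆ Set.Icc (-A) A →
        ∀ t : ℝ, (∫ s, (q (t - s) : ℂ) * weilMellin g (1 / 2 + (s : ℂ) * I)) =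
          weilMellin g (1 / 2 + (t : ℂ) * I)) →
      Continuous ν →
      (∀ g : ℝ → ℂ, IsWeilTest g → tsupport g ⊆ Set.Icc (-A) A →
        Integrable (fun t : ℝ => weilMellin g (1 / 2 + (t : ℂ) * I) * (ν t : ℂ)) ∧
        (∫ t : ℝ, weilMellin g (1 / 2 + (t : ℂ) * I) * (ν t : ℂ)) = weilFunctional g) →
      Continuous f → (∀ u, |f u| ≤ B) →
      (∀ u, f u = ∫ s, q (u - s) * Int.fract (Φ s)) →
      (∀ t, HasDerivAt Φ (dΦ t) t) → (∀ t, dΦ t = ν t + ∫ r, dq (t - r) * f r) →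
      Continuous (fun t => ∫ r, dq (t - r) * f r) →
      (∀ g : ℝ → ℂ, IsWeilTest g →
        HasSum (fun n : ℤ => weilMellin g (1 / 2 + ((Ψ n : ℝ) : ℂ) * I))
          ((∫ t : ℝ, weilMellin g (1 / 2 + (t : ℂ) * I) * (dΦ t : ℂ)) +
            ∫ t : ℝ, weilMellin (fun x : ℝ => I * (x : ℂ) * g x) (1 / 2 + (t : ℂ) * I) *
              ((Int.fract (Φ t) : ℝ) : ℂ))) →
      (∀ g : ℝ → ℂ, IsWeilTest g →
        (∀ t : ℝ, HasDerivAt (fun s : ℝ => weilMellin g (1 / 2 + (s : ℂ) * I))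
            (weilMellin (fun x : ℝ => I * (x : ℂ) * g x) (1 / 2 + (t : ℂ) * I)) t) ∧
        IsWeilTest (fun x : ℝ => I * (x : ℂ) * g x) ∧
        tsupport (fun x : ℝ => I * (x : ℂ) * g x) ⊆ tsupport g ∧
        ∃ C : ℝ, ∀ t : ℝ, ‖weilMellin g (1 / 2 + (t : ℂ) * I)‖ ≤ C / (1 + t ^ 2) ^ 2) →
      ∀ g : ℝ → ℂ, IsWeilTest g → tsupport g ⊆ Set.Ioo (-A) A →
        HasSum (fun n : ℤ => weilMellin g (1 / 2 + ((Ψ n : ℝ) : ℂ) * I)) (weilFunctional g) := by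
  intro A q dq ν f Φ dΦ Ψ Q B _hA hq hdqc hqeven hqb hdqb hqrep _hνc hνW hfc hfb hffix hΦd hdΦ
    hV'c hSBP hT g hg hgs
  have hgs' : tsupport g ⊆ Icc (-A) A := hgs.trans Ioo_subset_Icc_self
  obtain ⟨hGd, hxg, hxsupp, Cg, hCg⟩ := hT g hg
  obtain ⟨hG₁d, -, -, Cg₁, hCg₁⟩ := hT _ hxg
  set G : ℝ → ℂ := fun t : ℝ => weilMellin g (1 / 2 + (t : ℂ) * I) with hGdef
  set G₁ : ℝ → ℂ := fun t : ℝ => weilMellin (fun x : ℝ => I * (x : ℂ) * g x) (1 / 2 + (t : ℂ) * I)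
    with hG₁def
  have hGc : Continuous G := continuous_iff_continuousAt.2 fun t => (hGd t).continuousAt
  have hG₁c : Continuous G₁ := continuous_iff_continuousAt.2 fun t => (hG₁d t).continuousAt
  have hqc : Continuous q := continuous_iff_continuousAt.2 fun t => (hq t).continuousAt
  have hfm : AEStronglyMeasurable f := hfc.aestronglyMeasurable
  -- common decay constant
  have hGb : ∀ t, ‖G t‖ ≤ max Cg Cg₁ / (1 + t ^ 2) ^ 2 := fun t =>
    (hCg t).trans (div_le_div_of_nonneg_right (le_max_left _ _) (by positivity))
  have hG₁b : ∀ t, ‖G₁ t‖ ≤ max Cg Cg₁ / (1 + t ^ 2) ^ 2 := fun t =>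
    (hCg₁ t).trans (div_le_div_of_nonneg_right (le_max_right _ _) (by positivity))
  -- reproducing for `G₁`
  have hrep₁ : ∀ t : ℝ, (∫ s, (q (t - s) : ℂ) * G₁ s) = G₁ t :=
    hqrep _ hxg (hxsupp.trans hgs')
  -- the `W`-identity
  obtain ⟨hGνi, hW⟩ := hνW g hg hgs'
  -- (1) split `∫ ĝ Φ'`
  have hV'b : ∀ t, |∫ r, dq (t - r) * f r| ≤ (∫ s, |dq s|) * B := fun t =>
    FixedPoint.abs_integral_shift_mul_le hdqc hdqb hfb t
  have hsplit : (∫ t : ℝ, G t * (dΦ t : ℂ)) =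
      (∫ t : ℝ, G t * (ν t : ℂ)) + ∫ t : ℝ, G t * ((∫ r, dq (t - r) * f r : ℝ) : ℂ) := by
    rw [← integral_add hGνi (Verify.integrable_mul_bdd hGc hGb hV'c hV'b)]
    congr 1 with t
    rw [hdΦ t]; push_cast; ring
  -- (2) parts: `∫ ĝ (q' ∗ f) = −∫ ĝ₁ (q ∗ f)`
  have hparts := Verify.integral_mul_deriv_smear hGd hG₁c hGb hG₁b hq hdqc hqb hdqb hfc hfb
  -- (3) Fubini + reproducing: `∫ ĝ₁ (q ∗ f) = ∫ ĝ₁ f`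
  have hswap₁ : (∫ t, G₁ t * ((∫ r, q (t - r) * f r : ℝ) : ℂ)) = ∫ s, G₁ s * (f s : ℂ) := by
    rw [Verify.integral_mul_smear_swap hG₁c hG₁b hqc hqb hqeven hfm hfb]
    congr 1 with s
    rw [hrep₁ s]
  -- (4) Fubini + reproducing for the sawtooth: `∫ ĝ₁ f = ∫ ĝ₁ fract Φ`
  have hΦc : Continuous Φ := continuous_iff_continuousAt.2 fun t => (hΦd t).continuousAt
  have hφm : AEStronglyMeasurable fun s => Int.fract (Φ s) :=
    (measurable_fract.comp hΦc.measurable).aestronglyMeasurable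
  have hφb : ∀ s, |Int.fract (Φ s)| ≤ 1 := fun s => FixedPoint.abs_fract_le_one _
  have hswap₂ : (∫ s, G₁ s * (f s : ℂ)) = ∫ s, G₁ s * ((Int.fract (Φ s) : ℝ) : ℂ) := by
    have e : (fun s => G₁ s * (f s : ℂ)) =
        fun s => G₁ s * ((∫ r, q (s - r) * Int.fract (Φ r) : ℝ) : ℂ) := by
      funext s; rw [hffix s]
    rw [e, Verify.integral_mul_smear_swap hG₁c hG₁b hqc hqb hqeven hφm hφb]
    congr 1 with s
    rw [hrep₁ s]
  -- assemble
  have hval : (∫ t : ℝ, G t * (dΦ t : ℂ)) + (∫ t : ℝ, G₁ t * ((Int.fract (Φ t) : ℝ) : ℂ)) =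
      weilFunctional g := by
    rw [hsplit, hparts, hswap₁, hswap₂, hW]
    ring
  have h := hSBP g hg
  rw [hval] at h
  exact h

end Summit.RiemannHypothesis.RiemannHypothesis.Theorems.SpectralThesis.Sketch

end
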